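import Summits.HodgeConjecture.HodgeCM.Model.PadH6_2

/-! PORT of `HodgeCM/Model/PadH6.lean` (HodgeCMPerL run 82) — part 3: continuation of `Summits.HodgeConjecture.HodgeCM.Model.PadH6_2` (split at a top-level declaration boundary by port_pkg.py; scope re-opened below; declarations unchanged). -/

-- port_pkg: scope re-opened for this part (file-level context, then the namespace/section stack open at the cut)
noncomputable section
open scoped TensorProduct
namespace HodgeCM
open Literature.AlgebraicGeometry.Motives (CMType HodgeStructure)
open Literature.AlgebraicGeometry.Motives.HodgeStructure (EndAction ofRat complexConj prodEquiv pureFiltration)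
namespace Universe
variable (U : Universe)
namespace PadH6
variable {U}
/-- N2 `Fact_cup_hodge` transfers (the pad component of a cup product is `0`). -/
theorem fact_cup_hodge (h : U.Fact_cup_hodge) : U.padH6.Fact_cup_hodge := by
  intro X i j p q x y hx hy
  rw [mem_F_iff, toUC_cupC, padOfC_cupC]
  exact ⟨h X i j p q _ _ ((mem_F_iff (U := U) X i p x).mp hx).1 ((mem_F_iff (U := U) X j q y).mp hy).1,
    Submodule.zero_mem _⟩

/-- N3 `Fact_pull_H0` is literally the same statement for `U♯` and `U` (degree `0` is not padded). -/
theorem fact_pull_H0_iff : U.padH6.Fact_pull_H0 ↔ U.Fact_pull_H0 := Iff.rfl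

/-- N4 `Fact_hodge_F0` transfers (`F⁰ = ⊤` for the pure `(3,3)` pad). -/
theorem fact_hodge_F0 (h : U.Fact_hodge_F0) : U.padH6.Fact_hodge_F0 := by
  intro X k
  refine eq_top_iff.mpr fun x _ => ?_
  rw [mem_F_iff, h X k, HodgeStructure.pureFiltration_of_le (by norm_num)]
  exact ⟨Submodule.mem_top, Submodule.mem_top⟩

/-- F4 `Fact_cupAlg` transfers. -/
theorem fact_cupAlg (h : U.Fact_cupAlg) : U.padH6.Fact_cupAlg := by
  intro X p q x y hx hy
  rw [mem_alg_iff, toU_castCoh, toU_cup, padOf_castCoh, padOf_cup]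
  exact ⟨h X p q _ _ ((mem_alg_iff (U := U) X p x).mp hx).1 ((mem_alg_iff (U := U) X q y).mp hy).1, rfl⟩

/-- F5 `Fact_cupAssoc` transfers. -/
theorem fact_cupAssoc (h : U.Fact_cupAssoc) : U.padH6.Fact_cupAssoc := by
  intro X i j k a b c
  refine (ext_iff (U := U) X _ _ _).mpr ⟨?_, ?_⟩
  · rw [toU_cup, toU_cup, toU_castCoh, toU_cup, toU_cup]
    exact h X i j k _ _ _
  · rw [padOf_cup, padOf_castCoh, padOf_cup]

/-- `Fact_dimProd` is a statement about `dim` and `prod` only. -/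
theorem fact_dimProd_iff : U.padH6.Fact_dimProd ↔ U.Fact_dimProd := Iff.rfl

/-- `W_RK4` (degrees `1, 2, 4` only) is literally the same statement for `U♯` and `U`. -/
theorem w_RK4_iff : U.padH6.W_RK4 ↔ U.W_RK4 := Iff.rfl

/-- `RealisationExistsFace` (theta one-forms: degrees `1` and `4`) transfers verbatim. -/
theorem realisationExistsFace (h : U.RealisationExistsFace) : U.padH6.RealisationExistsFace := by
  intro F hG h6 f ι₁ hf V
  obtain ⟨r⟩ := h F hG h6 f ι₁ hf V
  exact ⟨{ r with }⟩

/-- `RealisationExistsPerL` transfers verbatim. -/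
theorem realisationExistsPerL (h : U.RealisationExistsPerL) : U.padH6.RealisationExistsPerL := by
  intro K L j hN hK hL φ hφ ι₁ hι t ht V
  obtain ⟨r⟩ := h K L j hN hK hL φ hφ ι₁ hι t ht V
  exact ⟨{ r with }⟩

section Weights

variable {F : CMField} {n : ℕ} (Θ : Fin (n + 1) → CMType F)

set_option smartUnfolding false in
/-- The CM products of `U♯` are those of `U` (definitionally). -/
theorem cmProd_eq : U.padH6.cmProd F Θ = U.cmProd F Θ := rfl

set_option smartUnfolding false in
/-- Factor-wise CM actions (a degree-one condition) are the same in `U♯` and in `U`. -/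
theorem isFactorAct_iff (j : Fin (n + 1)) (a : F) (M : U.Mor (U.cmProd F Θ) (U.cmProd F Θ)) :
    U.padH6.IsFactorAct F Θ j a M ↔ U.IsFactorAct F Θ j a M := Iff.rfl

set_option smartUnfolding false in
/-- **The pad component of a weight vector of `U♯` is a weight vector of `U` of the same weight** (in `H⁶`). -/
theorem isWeightVector_padOfC {S : Fin (n + 1) → Finset ((F : Type) →+* ℂ)} {k : ℕ}
    {x : U.padH6.CohC (U.padH6.cmProd F Θ) k} (hx : U.padH6.IsWeightVector F Θ S k x) :
    U.IsWeightVector F Θ S 6 (padOfC (U := U) (U.cmProd F Θ) k x) := by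
  intro j a M hM
  have h := congrArg (padOfC (U := U) (U.cmProd F Θ) k) (hx j a M ((isFactorAct_iff Θ j a M).mpr hM))
  exact (padOfC_pullC (U := U) M k x).symm.trans (h.trans (map_smul _ _ _))

set_option smartUnfolding false in
/-- The geometric component of a weight vector of `U♯` is a weight vector of `U` of the same weight and degree. -/
theorem isWeightVector_toUC {S : Fin (n + 1) → Finset ((F : Type) →+* ℂ)} {k : ℕ}
    {x : U.padH6.CohC (U.padH6.cmProd F Θ) k} (hx : U.padH6.IsWeightVector F Θ S k x) :
    U.IsWeightVector F Θ S k (toUC (U := U) (U.cmProd F Θ) k x) := by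
  intro j a M hM
  have h := congrArg (toUC (U := U) (U.cmProd F Θ) k) (hx j a M ((isFactorAct_iff Θ j a M).mpr hM))
  exact (toUC_pullC (U := U) M k x).symm.trans (h.trans (map_smul _ _ _))

end Weights

/-- **Every pad vector is a rational Hodge class of `H♯⁶`** (the pad is purely of type `(3,3)`). -/
theorem ofPad_mem_hodgeClassesOf (X : U.Var) (v : U.Coh X 6) :
    (ofPad X 6 v : U.padH6.Coh X (2 * 3)) ∈ U.padH6.hodgeClassesOf X 3 := by
  show (ofRat ((0, v) : U.Coh X 6 × U.Coh X 6) : U.padH6.CohC X 6) ∈ (U.padH6.hodge X 6).F ((3 : ℕ) : ℤ)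
  rw [ofRat_mem_F_iff, padOf_six, toU_six, map_zero, HodgeStructure.pureFiltration_of_le (by norm_num)]
  exact ⟨Submodule.zero_mem _, Submodule.mem_top⟩

/-- … and it is algebraic only if it is `0`. -/
theorem ofPad_mem_alg_iff (X : U.Var) (v : U.Coh X 6) :
    (ofPad X 6 v : U.padH6.Coh X (2 * 3)) ∈ U.padH6.alg X 3 ↔ v = 0 := by
  rw [show U.padH6.alg X 3 = (U.alg X 3).prod ⊥ from rfl, ofPad_six, Submodule.mem_prod, Submodule.mem_bot]
  exact ⟨fun h => h.2, fun h => ⟨(Submodule.zero_mem _), h⟩⟩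

/-! ## 6. Pohlmann's span theorem FAILS in `U♯` (for `U` a model with N1) -/

/-- The weight `({φ₀}, …, {φ₀})` on six factors of the same CM type is never a Hodge weight in codimension `3`:
at the trivial Galois translate the count `#{(j,s) : s ∈ Θ_j}` is `6 · 1_Φ(φ₀) ∈ {0, 6}`, not `3`. -/
theorem not_isHodgeWeight_const_singleton {F : Type} [Field F] [NumberField F] (Φ : CMType F) (φ₀ : F →+* ℂ) :
    ¬ IsHodgeWeight (fun _ : Fin (5 + 1) => Φ) 3 (fun _ => ({φ₀} : Finset (F →+* ℂ))) := by
  rintro ⟨-, h⟩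
  have h1 := h 1
  simp only [Finset.sum_singleton, GalT.one_apply, Finset.sum_const, Finset.card_univ, Fintype.card_fin,
    ind] at h1
  split_ifs at h1 <;> norm_num at h1

set_option smartUnfolding false in
/-- **`¬ PohlmannSpan` in `U♯`.**  Take a Galois CM field `F` of degree `≥ 6` with a CM type `Φ` and an embedding
`φ₀` (inhabited: `faceHypothesesInhabited`), `A′ = A_Φ⁶` (`n = 5`) and `p = 3`.  Every pad vector `(0, v)`,
`v ∈ H⁶(A′, ℚ)`, is a rational Hodge class of `H♯⁶(A′)`; the pad component of a weight vector of `U♯` of weight `S` is a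
weight vector of `U` of weight `S`; so the span inclusion in `U♯` forces EVERY `1 ⊗ v` into
`W = Σ_{S Hodge} V_S ⊂ H⁶(A′, ℂ)`, i.e. `W = H⁶(A′, ℂ)`.  But the weight space of the non-Hodge weight `({φ₀}, …, {φ₀})`
is a LINE (`finrank_weightSpace`, from `ModelAxioms` + N1) independent of `W` (`iSupIndep_weightSpace`). -/
theorem not_pohlmannSpan (M : U.ModelAxioms) (hN1 : U.Fact_cupExterior) : ¬ U.padH6.PohlmannSpan := by
  intro hP
  obtain ⟨F, hG, h6, f, φ₀, -⟩ := faceHypothesesInhabited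
  let Θ : Fin (5 + 1) → CMType F := fun _ => f.Φ
  let S₀ : Fin (5 + 1) → Finset ((F : Type) →+* ℂ) := fun _ => {φ₀}
  have hS₀ : ¬ IsHodgeWeight Θ 3 S₀ := not_isHodgeWeight_const_singleton f.Φ φ₀
  -- the weight space of `S₀` in degree six is a line
  have hline : Module.finrank ℂ (U.weightSpace F Θ S₀ 6) = 1 := by
    rw [finrank_weightSpace M hN1 (by norm_num) S₀, if_pos]
    simp [S₀]
  -- `W = Σ_{S Hodge} V_S` misses it
  let W : Submodule ℂ (U.CohC (U.cmProd F Θ) 6) := ⨆ (S) (_ : IsHodgeWeight Θ 3 S), U.weightSpace F Θ S 6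
  have hdisj : Disjoint (U.weightSpace F Θ S₀ 6) W :=
    (iSupIndep_weightSpace M 6 S₀).mono_right
      (iSup₂_le fun S hS => le_iSup₂_of_le S (fun hSS : S = S₀ => hS₀ (hSS ▸ hS)) le_rfl)
  -- the pad projection `π : H♯⁶(A′, ℂ) → H⁶(A′, ℂ)` maps the Hodge weight vectors of `U♯` into `W`
  let π : U.padH6.CohC (U.padH6.cmProd F Θ) (2 * 3) →ₗ[ℂ] U.CohC (U.cmProd F Θ) 6 := padOfC (U := U) (U.cmProd F Θ) 6
  have hT : {x : U.padH6.CohC (U.padH6.cmProd F Θ) (2 * 3) |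
      ∃ S : Fin (5 + 1) → Finset ((F : Type) →+* ℂ), IsHodgeWeight Θ 3 S ∧ U.padH6.IsWeightVector F Θ S (2 * 3) x} ⊆
      (W.comap π : Submodule ℂ _) := by
    rintro x ⟨S, hS, hx⟩
    exact Submodule.mem_iSup_of_mem S (Submodule.mem_iSup_of_mem hS (isWeightVector_padOfC Θ hx))
  -- so by Pohlmann's span inclusion in `U♯` every `1 ⊗ v`, `v ∈ H⁶(A′, ℚ)`, lies in `W`
  have hall : ∀ v : U.Coh (U.cmProd F Θ) 6, (ofRat v : U.CohC (U.cmProd F Θ) 6) ∈ W := by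
    intro v
    have hv := hP F hG h6 5 Θ 3 ⟨ofPad (U := U) (U.cmProd F Θ) 6 v, ofPad_mem_hodgeClassesOf (U := U) _ v, rfl⟩
    have hW := Submodule.mem_comap.mp (Submodule.span_le.mpr hT hv)
    have hπ : π (ofRat (ofPad (U := U) (U.cmProd F Θ) 6 v)) = ofRat v := padOfC_ofRat (U := U) _ 6 _
    rwa [hπ] at hW
  have htop : W = ⊤ := PadSix.eq_top_of_forall_ofRat_mem hall
  have hbot : U.weightSpace F Θ S₀ 6 = ⊥ := disjoint_top.mp (htop ▸ hdisj)
  rw [hbot, finrank_bot] at hline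
  exact zero_ne_one hline

/-- Hence **N1 `Fact_cupExterior` FAILS in `U♯`** whenever `U` is a model with N1–N4 and `Fact_dimProd` — N1 is the
load-bearing input of `pohlmannSpan_of_facts`: `U♯` keeps `ModelAxioms`, N2, N3, N4 and loses `PohlmannSpan`. -/
theorem not_fact_cupExterior (M : U.ModelAxioms) (hd : U.Fact_dimProd) (hN1 : U.Fact_cupExterior)
    (hN2 : U.Fact_cup_hodge) (hN3 : U.Fact_pull_H0) (hN4 : U.Fact_hodge_F0) : ¬ U.padH6.Fact_cupExterior :=
  fun h => not_pohlmannSpan M hN1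
    (pohlmannSpan_of_facts (modelAxioms M hd) h (fact_cup_hodge hN2) (fact_pull_H0_iff.mpr hN3) (fact_hodge_F0 hN4))

/-- **`OpenInputs` fails in `U♯`** (its field `pohlmann_span`). -/
theorem not_openInputs (M : U.ModelAxioms) (hN1 : U.Fact_cupExterior) : ¬ U.padH6.OpenInputs :=
  fun h => not_pohlmannSpan M hN1 h.pohlmann_span

set_option smartUnfolding false in
/-- **COR-CM fails in `U♯`**: for a CM type `Φ` of a Galois CM field of degree `2g ≥ 6`, `H⁶(A_Φ, ℂ) ≠ 0` (it contains
the weight LINE of any weight of size `6`: `finrank_weightSpace`), so some pad vector `(0, v)`, `v ≠ 0`, is a rational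
Hodge class of `H♯⁶(A_Φ)` which is not algebraic (`Alg♯³ = Alg³ ⊕ 0`). -/
theorem not_hc_cm (M : U.ModelAxioms) (hN1 : U.Fact_cupExterior) : ¬ U.padH6.HC_CM := by
  intro hHC
  obtain ⟨F, hG, h6, f, φ₀, -⟩ := faceHypothesesInhabited
  let Θ : Fin (0 + 1) → CMType F := fun _ => f.Φ
  have hcard : 6 ≤ (Finset.univ : Finset ((F : Type) →+* ℂ)).card := by
    rw [Finset.card_univ, NumberField.Embeddings.card]; exact h6
  obtain ⟨T, -, hT⟩ := Finset.exists_subset_card_eq hcard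
  have hline : Module.finrank ℂ (U.weightSpace F Θ (fun _ => T) 6) = 1 := by
    rw [finrank_weightSpace M hN1 (by norm_num), if_pos]
    simp [hT]
  -- every `v ∈ H⁶(A_Φ, ℚ)` vanishes: its pad vector is a Hodge class, hence algebraic by COR-CM in `U♯`, hence `v = 0`
  have hX : U.padH6.IsCMAbelianVariety (U.cmProd F Θ) := (M.cmAV F f.Φ).2.1
  have hv : ∀ v : U.Coh (U.cmProd F Θ) 6, v = 0 := fun v =>
    (ofPad_mem_alg_iff (U := U) _ v).mp (hHC _ hX 3 (ofPad_mem_hodgeClassesOf (U := U) _ v))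
  have hz : ∀ z : U.CohC (U.cmProd F Θ) 6, z = 0 := fun z => by
    induction z using TensorProduct.induction_on with
    | zero => rfl
    | tmul c v => rw [hv v, TensorProduct.tmul_zero]
    | add x y hx hy => rw [hx, hy, add_zero]
  have hpos : 0 < Module.finrank ℂ (U.weightSpace F Θ (fun _ => T) 6) := by rw [hline]; exact Nat.one_pos
  obtain ⟨w, hw⟩ := Module.finrank_pos_iff_exists_ne_zero.mp hpos
  exact hw (Subtype.ext (hz _))

end PadH6

/-- **Separation theorem for `pohlmann_span`.**  If the axiom system `ModelAxioms ∧ N1 ∧ N2 ∧ N3 ∧ N4 ∧ Fact_dimProd`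
has a model at all, then it has a model of `ModelAxioms ∧ N2 ∧ N3 ∧ N4 ∧ Fact_dimProd` in which `PohlmannSpan` — and with
it N1, `OpenInputs` and COR-CM — FAILS: the open input `pohlmann_span` is not a consequence of the model axioms and the
three facts N2–N4.  (The unconditional instance: `HodgeCM.Model.Toy.ToyPadH6`.) -/
theorem exists_model_not_pohlmannSpan
    (h : ∃ U : Universe, U.ModelAxioms ∧ U.Fact_cupExterior ∧ U.Fact_cup_hodge ∧ U.Fact_pull_H0 ∧ U.Fact_hodge_F0 ∧
      U.Fact_dimProd) :
    ∃ U : Universe, U.ModelAxioms ∧ U.Fact_cup_hodge ∧ U.Fact_pull_H0 ∧ U.Fact_hodge_F0 ∧ U.Fact_dimProd ∧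
      ¬ U.PohlmannSpan ∧ ¬ U.Fact_cupExterior ∧ ¬ U.OpenInputs ∧ ¬ U.HC_CM := by
  obtain ⟨U, M, hN1, hN2, hN3, hN4, hd⟩ := h
  exact ⟨U.padH6, PadH6.modelAxioms M hd, PadH6.fact_cup_hodge hN2, PadH6.fact_pull_H0_iff.mpr hN3,
    PadH6.fact_hodge_F0 hN4, PadH6.fact_dimProd_iff.mpr hd, PadH6.not_pohlmannSpan M hN1,
    PadH6.not_fact_cupExterior M hd hN1 hN2 hN3 hN4, PadH6.not_openInputs M hN1, PadH6.not_hc_cm M hN1⟩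

end Universe

end HodgeCM

end
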